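import Summits.QuantumFields.YangMills.Theorems.FluctuationComparisonRegPrIntLS2BetaArcDecayOfGuard
import HarnessLib

/-!
# S2β · THE SUP CHAIN ∕ (D-stage): THE DECAYED ARC PROFILE AT EVERY LEVEL BELOW THE TOP (the finest level included) — the all-levels edition of ✓p836168
# `arcDecay_of_guard`: `∀ i < K − J` instead of `1 ≤ i < K − J`, same station prefix, same constants, same generic guard threshold `s₀ ≤ 1∕128`

Cell `ym3-torus` (rung R3 = continuum `SU(2)` Yang–Mills on T³ at fixed lattice data — NOT d = 4, NOT infinite volume, NOT a mass gap, NOT Clay).  Width seat «width 12»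
`ym3-torus-px12` (gen 26), FREE px helper on crux `stmt-QuantumFields-20520`; `--supports` helper, count-neutral, DEFINITION-FREE (0 `def`∕`instance`∕`notation`∕`sorry`,
default heartbeats).

WHY (px21 g25 00:31:09Z FINDING «THE FINEST LEVEL HAS NO ARC LETTER»: FILE P's size letters `hsU`∕`hsA` range over all `t < K − J`, i.e. heights `s ∈ {0, …, K−J−1}`,
while ✓Q §2 and ✓N conclude for `1 ≤ i` only — so ρ-PACK's uniform `σM` had no supplier at height 0).  The restriction was cosmetic: ✓Q §1 `exists_alpha_arcDecay_window`
is stated for EVERY gauged level `t ≤ K − J`, and `0 < α` follows from `i < K − J` alone (a window level exists).  THIS FILE re-runs ✓Q §2's plumbing with the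
conclusion quantified over all `i < K − J` (exit (Q′) of the finding; a separate file only to respect the 400-line limit — ✓Q is untouched).

WHAT IS PROVED (sorry-free).  ★★★`arcDecay_of_guard_below G s₀ hs₀ hGs : ∀ L > 1, ∀ C_B ≥ 0, ∃ α₀ > 0, ∃ q ∈ [0,1), ∃ D₁ ≥ 0, ∀ F, F.L = L → ⟨station prefix VERBATIM⟩ →
∀ i, i < K − J → ∀ e, arc((g_i • Ū^i(e^ζU₀)) e) ≤ s₀·q^(K−J−i) + D₁·α ∧ arc((g₀_i • Ū^iU₁) e) ≤ s₀·q^(K−J−i) + D₁·α`.  (At the top `i = K − J` the arcs are `≤ s₀` by the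
guard itself; ρ-PACK reads `σM := s₀ + D₁·α₀` at every height.)

HONEST SCOPE.  Re-plumbing of a landed letter; window, (BKG), (E4), memberships, the 17 `AxStage` clauses are HYPOTHESES; DOMAIN (№115 R5): every datum class `G` with
the small-bond conjunct `arc ≤ s₀` — not reachable by gauge below `N_J = π∕s₀`; nothing of Bałaban's renormalisation-group analysis is asserted or proved
([Balaban1985RegularSpaces] Lemma 1 (1.24)–(1.26) p.79, (1.29) p.81).  FB-σ's smallness (G1′), the ρ̃ inhabitant, the knit, GAP♯∘ (registry untouched by me), the five
registered stubs (0∕5), S2β, 20520, 19936, 19200, `YM3TorusSU2` are NOT proved; rung R3 — NOT d = 4, NOT infinite volume, NOT a mass gap, NOT Clay; the Yang–Mills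
mass gap is NOT proved.
-/

set_option autoImplicit false

noncomputable section

namespace Summit.QuantumFields.YangMills.Theorems.FluctuationComparisonRegPrIntLS2BetaArcDecayOfGuardBelow

open Finset
open scoped Real
open Literature.MathematicalPhysics.QuantumLattice (su2Quat)
open Literature.MathematicalPhysics.QuantumFieldTheory.Balaban1983to89
open T4Continuum T3ContinuumYM3Torus T3UnitScaleTilt T3TiltDescent T3LevelShift BlockAveraging
open T4CubeChartGnomonic (SU2)
open T4HaarSU2ExpChart (expPoint)
open T4ExpWindowSmallField (logVec)
open T3UnitLawDensityEML (ℰp)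
open T3ConstrainedMinimiser (fibre)
open ExpMeanLog (deltaSU)
open B10Eq27TorusAxialLog (rel axialT)
open Summit.QuantumFields.YangMills.Theorems.FluctuationComparisonRegPrIntLS2BetaRelativeTowerSupProfileStart (exists_supProfile_relativeTower_start)
open Summit.QuantumFields.YangMills.Theorems.FluctuationComparisonRegPrIntLS2BetaRelativeTowerSupBudgetStart (norm_logVec_iter_le_of_mem_fibre)
open Summit.QuantumFields.YangMills.Theorems.FluctuationComparisonRegPrIntLS2BetaRelativeTowerSupBudget128 (one_div_128_le_ceiling)
open Summit.QuantumFields.YangMills.Theorems.FluctuationComparisonRegPrIntLS2BetaResidualGauge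
  (gaugeAct_mul_eq gaugeAct_mem_fibre_iff_of_residual gaugeAct_mem_histGood_iff)
open Summit.QuantumFields.YangMills.Theorems.FluctuationComparisonRegPrIntLS2BetaHFlatOfRelativeLetter (residual_of_iter_eq)
open Summit.QuantumFields.YangMills.Theorems.FluctuationComparisonRegPrIntLS2BetaPeanoSmooth (iter_eq_of_descendTo_eq)
open Summit.QuantumFields.YangMills.Theorems.FluctuationComparisonRegPrIntLS2BetaArcDecayOfGuard (exists_alpha_arcDecay_window)

/-- ★★★ **THE DECAYED ARC PROFILE AT EVERY LEVEL BELOW THE TOP** : as ✓`arcDecay_of_guard`, with the conclusion quantified over ALL gauged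
levels `i < K − J` — the FINEST level `i = 0` included (§1's core is stated for every `t ≤ K − J`; §2's `1 ≤ i` only mirrored `hARC`'s shape).  Supplies FILE P's
size letters `sU, sA` down to height `0` (ρ-PACK's `σM := s₀ + D₁·α₀` uniform in the level).  **THE DECAYED ARC PROFILE AT THE STATION PREFIX, FROM THE GUARD**: for every datum class `G` with a small-bond conjunct of ANY threshold `s₀ ≤ 1∕128`,
`∃ α₀(L,C_B) > 0, ∃ q(L) ∈ [0,1), ∃ D₁(L,C_B) ≥ 0` (all `s₀`-free) and — under the station prefix of LEAD's knit VERBATIM — every internal gauged level `1 ≤ i < K − J`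
of BOTH stage towers has arcs `≤ s₀·q^(K−J−i) + D₁·α` (§1 on each tower; `0 < α` read off `U₀ ∈ histGood θ` at the finest level and the window at `i = K`; memberships as in
✓`arcLetter_of_guard`). [cite: Balaban1985RegularSpaces, Lemma 1 (1.24)-(1.26) p.79, (1.29) p.81; Balaban1985Averaging, Prop. 4 (128)-(135) pp.37-38] -/
theorem arcDecay_of_guard_below
    (G : (F : T3Family) → (J : ℕ) → GaugeField (F.P J) 0 (Matrix.specialUnitaryGroup (Fin 2) ℂ) → Prop) (s₀ : ℝ) (hs₀ : s₀ ≤ 1 / 128)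
    (hGs : ∀ (F : T3Family) (J : ℕ) (V : GaugeField (F.P J) 0 (Matrix.specialUnitaryGroup (Fin 2) ℂ)),
      G F J V → ∀ e, ‖logVec (su2Quat (V e))‖ ≤ s₀) :
      ∀ (L : ℕ), 1 < L → ∀ (C_B : ℝ), 0 ≤ C_B → ∃ α₀ : ℝ, 0 < α₀ ∧ ∃ q : ℝ, 0 ≤ q ∧ q < 1 ∧ ∃ D₁ : ℝ, 0 ≤ D₁ ∧ ∀ (F : T3Family), F.L = L →
      ∀ (J K : ℕ) (hJK : J ≤ K) (θ : ℕ → ℝ), (∀ i, 0 ≤ θ i) → ∀ (α : ℝ), (∀ i, J < i → i ≤ K → (((5 * F.L : ℕ) : ℝ) ^ 2 / 4) * θ i ≤ α) →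
        α ≤ 1 / 24 → α < deltaSU (Fin 2) → 157 * α < ((F.L : ℝ) ^ 2)⁻¹ → α ≤ α₀ →
        ∀ U₀ : GaugeField (F.P K) 0 (Matrix.specialUnitaryGroup (Fin 2) ℂ), U₀ ∈ histGood F ℰp θ K J →
        G F J (descendTo F ℰp J K hJK U₀) →
        (∀ t, t ≤ K - J → ∀ p : Plaq (F.P K) t,
          dist1 (GaugeField.plaqHol (Averaging.iter (fun k => BlockAveraging.blockAvg (P := F.P K) (j := k) ℰp) t U₀) p) ≤
            C_B * α * (F.L : ℝ) ^ (2 * t) * ((F.L : ℝ)⁻¹) ^ (2 * (K - J))) →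
        ∀ ζ : PBond (F.P K) 0 → EuclideanSpace ℝ (Fin 3), (∀ ℓ, ‖ζ ℓ‖ ≤ Real.pi) →
          (fun ℓ => expPoint (ζ ℓ) * U₀ ℓ : GaugeField (F.P K) 0 (Matrix.specialUnitaryGroup (Fin 2) ℂ)) ∈ histGood F ℰp θ K J →
            descendTo F ℰp J K hJK (fun ℓ => expPoint (ζ ℓ) * U₀ ℓ : GaugeField (F.P K) 0 (Matrix.specialUnitaryGroup (Fin 2) ℂ)) = descendTo F ℰp J K hJK U₀ →
            ∀ (wt : (j : ℕ) → PBond (F.P K) j → PBond (F.P K) (j + 1) → ℝ)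
            (lift : (j : ℕ) → GaugeField (F.P K) (j + 1) SU2 → GaugeField (F.P K) j SU2)
            (U₁ : GaugeField (F.P K) 0 SU2) (g g₀ : (j : ℕ) → Site (F.P K) j → SU2),
          (∀ j b e, wt j b e = if e.dir = b.dir ∧ (b.src b.dir - emb e.src b.dir).val < (F.P K).L then
              ∏ ν ∈ Finset.univ.erase b.dir, max 0 (1 - ((rel (emb e.src) b.src ν).natAbs : ℝ) / (F.P K).L) else 0) →
          (∀ j X b, lift j X b = expPoint (∑ e, wt j b e • ((((F.P K).L : ℕ) : ℝ)⁻¹ • logVec (su2Quat (X e))))) →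
          (∀ j, j < K - J → ∀ x, g j x =
            (axialT (lift j (GaugeField.gaugeAct (g (j + 1)) (Averaging.iter (fun k => blockAvg (P := F.P K) (j := k) ℰp) (j + 1) (fun ℓ => expPoint (ζ ℓ) * U₀ ℓ))))
                (emb (blockOf x)) x)⁻¹ *
              g (j + 1) (blockOf x) * axialT (Averaging.iter (fun k => blockAvg (P := F.P K) (j := k) ℰp) j (fun ℓ => expPoint (ζ ℓ) * U₀ ℓ)) (emb (blockOf x)) x) →
          (∀ j, K - J ≤ j → ∀ y, g j y = 1) →
          (∀ j, j < K - J → ∀ y : Site (F.P K) (j + 1), g j (emb y) = g (j + 1) y) →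
          (∀ X : GaugeField (F.P K) 0 SU2, ∀ j, j ≤ K - J →
            Averaging.iter (fun k => blockAvg (P := F.P K) (j := k) ℰp) j (GaugeField.gaugeAct (g 0) X) =
              GaugeField.gaugeAct (g j) (Averaging.iter (fun k => blockAvg (P := F.P K) (j := k) ℰp) j X)) →
          (∀ j, j < K - J → ∀ x,
            axialT (GaugeField.gaugeAct (g j) (Averaging.iter (fun k => blockAvg (P := F.P K) (j := k) ℰp) j (fun ℓ => expPoint (ζ ℓ) * U₀ ℓ))) (emb (blockOf x)) x =
              axialT (lift j (GaugeField.gaugeAct (g (j + 1)) (Averaging.iter (fun k => blockAvg (P := F.P K) (j := k) ℰp) (j + 1) (fun ℓ => expPoint (ζ ℓ) * U₀ ℓ))))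
                (emb (blockOf x)) x) →
          (∀ j, j < K - J →
            (blockAvg (P := F.P K) (j := j) ℰp).avg (GaugeField.gaugeAct (g j) (Averaging.iter (fun k => blockAvg (P := F.P K) (j := k) ℰp) j (fun ℓ => expPoint (ζ ℓ) * U₀ ℓ))) =
              GaugeField.gaugeAct (g (j + 1)) (Averaging.iter (fun k => blockAvg (P := F.P K) (j := k) ℰp) (j + 1) (fun ℓ => expPoint (ζ ℓ) * U₀ ℓ))) →
          (∀ j, j < K - J → ∀ x, g₀ j x =
            (axialT (lift j (GaugeField.gaugeAct (g₀ (j + 1)) (Averaging.iter (fun k => blockAvg (P := F.P K) (j := k) ℰp) (j + 1) U₁)))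
                (emb (blockOf x)) x)⁻¹ *
              g₀ (j + 1) (blockOf x) * axialT (Averaging.iter (fun k => blockAvg (P := F.P K) (j := k) ℰp) j U₁) (emb (blockOf x)) x) →
          (∀ j, K - J ≤ j → ∀ y, g₀ j y = 1) →
          (∀ j, j < K - J → ∀ y : Site (F.P K) (j + 1), g₀ j (emb y) = g₀ (j + 1) y) →
          (∀ X : GaugeField (F.P K) 0 SU2, ∀ j, j ≤ K - J →
            Averaging.iter (fun k => blockAvg (P := F.P K) (j := k) ℰp) j (GaugeField.gaugeAct (g₀ 0) X) =
              GaugeField.gaugeAct (g₀ j) (Averaging.iter (fun k => blockAvg (P := F.P K) (j := k) ℰp) j X)) →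
          (∀ j, j < K - J → ∀ x,
            axialT (GaugeField.gaugeAct (g₀ j) (Averaging.iter (fun k => blockAvg (P := F.P K) (j := k) ℰp) j U₁)) (emb (blockOf x)) x =
              axialT (lift j (GaugeField.gaugeAct (g₀ (j + 1)) (Averaging.iter (fun k => blockAvg (P := F.P K) (j := k) ℰp) (j + 1) U₁)))
                (emb (blockOf x)) x) →
          (∀ j, j < K - J →
            (blockAvg (P := F.P K) (j := j) ℰp).avg (GaugeField.gaugeAct (g₀ j) (Averaging.iter (fun k => blockAvg (P := F.P K) (j := k) ℰp) j U₁)) =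
              GaugeField.gaugeAct (g₀ (j + 1)) (Averaging.iter (fun k => blockAvg (P := F.P K) (j := k) ℰp) (j + 1) U₁)) →
          (∀ X : GaugeField (F.P K) 0 SU2, Averaging.iter (fun k => blockAvg (P := F.P K) (j := k) ℰp) (K - J) (GaugeField.gaugeAct (fun x => (g 0 x)⁻¹) X) = Averaging.iter (fun k => blockAvg (P := F.P K) (j := k) ℰp) (K - J) X) →
          (∀ X : GaugeField (F.P K) 0 SU2, Averaging.iter (fun k => blockAvg (P := F.P K) (j := k) ℰp) (K - J) (GaugeField.gaugeAct (g₀ 0) X) = Averaging.iter (fun k => blockAvg (P := F.P K) (j := k) ℰp) (K - J) X) →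
          U₀ = GaugeField.gaugeAct (fun x => (g 0 x)⁻¹ * g₀ 0 x) U₁ →

                      ∀ i, i < K - J → ∀ e : PBond (F.P K) i,
            ‖logVec (su2Quat (GaugeField.gaugeAct (g i) (Averaging.iter (fun k => blockAvg (P := F.P K) (j := k) ℰp) i (fun ℓ => expPoint (ζ ℓ) * U₀ ℓ)) e))‖ ≤
                s₀ * q ^ (K - J - i) + D₁ * α ∧
            ‖logVec (su2Quat (GaugeField.gaugeAct (g₀ i) (Averaging.iter (fun k => blockAvg (P := F.P K) (j := k) ℰp) i U₁) e))‖ ≤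
                s₀ * q ^ (K - J - i) + D₁ * α := by
  intro L hL C_B hCB
  obtain ⟨α₀, hα₀, q, hq0, hq1, D₁, hD₁, H⟩ := exists_alpha_arcDecay_window L hL C_B hCB
  refine ⟨α₀, hα₀, q, hq0, hq1, D₁, hD₁, ?_⟩
  intro F hFL J K hJK θ hθ0 α hwin h24 hδ _h157 hαα U₀ hU₀g hG hBKG ζ _hζ hWg hfib wt lift U₁ g g₀ hwt hlift _hg hgtop _hgemb _hT3 hT4 havg
    _hg₀ hg₀top _hg₀emb _hT3' hT4' havg₀ hres hres₀ hU₀ i hiK e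
  -- `0 < α`: the finest-level plaquettes of `U₀` are `< θ K` (histGood), and the window at `i = K` reads `((5L)²∕4)·θ K ≤ α`
  have hPd : (F.P K).d = 3 := rfl
  have hαpos : 0 < α := by
    have hd1 : 1 < (F.P K).d := by rw [hPd]; norm_num
    have p₀ : Plaq (F.P K) 0 := ⟨default, ⟨0, by omega⟩, ⟨1, hd1⟩, by show (0 : ℕ) < 1; norm_num⟩
    have h1 := hU₀g 0 (by omega) p₀
    have h3 : 0 < θ (K - 0) := lt_of_le_of_lt (GaugeGroup.dist1_nonneg _) h1
    rw [Nat.sub_zero] at h3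
    have h2 := hwin K (by omega) le_rfl
    have hG5 : (0 : ℝ) < ((5 * F.L : ℕ) : ℝ) ^ 2 / 4 := by
      have : (0 : ℝ) < ((5 * F.L : ℕ) : ℝ) := by rw [hFL]; exact_mod_cast (show 0 < 5 * L by omega)
      positivity
    exact lt_of_lt_of_le (mul_pos hG5 h3) h2
  have hV : ∀ e', ‖logVec (su2Quat (descendTo F ℰp J K hJK U₀ e'))‖ ≤ s₀ := hGs F J _ hG
  have hFL0 : (0 : ℝ) < (F.L : ℝ) := by rw [hFL]; exact_mod_cast (lt_trans Nat.zero_lt_one hL)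
  have hLL : (F.L : ℝ) ^ (2 * (K - J)) * ((F.L : ℝ)⁻¹) ^ (2 * (K - J)) = 1 := by
    rw [← mul_pow, mul_inv_cancel₀ hFL0.ne', one_pow]
  have htop₀ : ∀ p : Plaq (F.P K) (K - J),
      dist1 (GaugeField.plaqHol (Averaging.iter (fun k => blockAvg (P := F.P K) (j := k) ℰp) (K - J) U₀) p) ≤ C_B * α := by
    intro p
    have h := hBKG (K - J) le_rfl p
    rw [mul_assoc (C_B * α), hLL, mul_one] at h
    exact h
  -- the partner `W := exp(ζ)·U₀`: in the datum's fibre by (E4) (`hfib` itself), same top field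
  have hWtop : ∀ p : Plaq (F.P K) (K - J),
      dist1 (GaugeField.plaqHol (Averaging.iter (fun k => blockAvg (P := F.P K) (j := k) ℰp) (K - J)
        (fun ℓ => expPoint (ζ ℓ) * U₀ ℓ : GaugeField (F.P K) 0 (Matrix.specialUnitaryGroup (Fin 2) ℂ))) p) ≤ C_B * α := by
    intro p
    rw [iter_eq_of_descendTo_eq F hJK hfib]
    exact htop₀ p
  have hwres : ∀ X : GaugeField (F.P K) 0 SU2,
      descendTo F ℰp J K hJK (GaugeField.gaugeAct (fun x => (g 0 x)⁻¹ * g₀ 0 x) X) = descendTo F ℰp J K hJK X := by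
    refine residual_of_iter_eq F hJK _ fun X => ?_
    have e1 : GaugeField.gaugeAct (fun x => (g 0 x)⁻¹ * g₀ 0 x) X =
        GaugeField.gaugeAct (fun x => (g 0 x)⁻¹) (GaugeField.gaugeAct (g₀ 0) X) := gaugeAct_mul_eq (fun x => (g 0 x)⁻¹) (g₀ 0) X
    rw [e1, hres, hres₀]
  have hU₁f : U₁ ∈ fibre F ℰp J K hJK (descendTo F ℰp J K hJK U₀) := by
    rw [← gaugeAct_mem_fibre_iff_of_residual F hJK hwres U₁, ← hU₀]; exact rfl
  have hU₁g : U₁ ∈ histGood F ℰp θ K J := by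
    rw [← gaugeAct_mem_histGood_iff F (fun x => (g 0 x)⁻¹ * g₀ 0 x) θ J U₁, ← hU₀]; exact hU₀g
  have hU₁top : ∀ p : Plaq (F.P K) (K - J),
      dist1 (GaugeField.plaqHol (Averaging.iter (fun k => blockAvg (P := F.P K) (j := k) ℰp) (K - J) U₁) p) ≤ C_B * α := by
    intro p
    have e1 : Averaging.iter (fun k => blockAvg (P := F.P K) (j := k) ℰp) (K - J) U₁ =
        Averaging.iter (fun k => blockAvg (P := F.P K) (j := k) ℰp) (K - J) U₀ := by
      have e2 : GaugeField.gaugeAct (fun x => (g 0 x)⁻¹ * g₀ 0 x) U₁ =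
          GaugeField.gaugeAct (fun x => (g 0 x)⁻¹) (GaugeField.gaugeAct (g₀ 0) U₁) := gaugeAct_mul_eq (fun x => (g 0 x)⁻¹) (g₀ 0) U₁
      rw [hU₀, e2, hres, hres₀]
    rw [e1]
    exact htop₀ p
  constructor
  · exact H F θ hFL hθ0 J K hJK α hwin hαpos h24 hδ hαα s₀ hs₀ (descendTo F ℰp J K hJK U₀) hV _ hfib hWg hWtop g wt
      (fun t => lift t (GaugeField.gaugeAct (g (t + 1)) (Averaging.iter (fun k => blockAvg (P := F.P K) (j := k) ℰp) (t + 1)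
        (fun ℓ => expPoint (ζ ℓ) * U₀ ℓ : GaugeField (F.P K) 0 (Matrix.specialUnitaryGroup (Fin 2) ℂ)))))
      (fun t _ b e' => hwt t b e') (fun t _ b => hlift t _ b) hgtop (fun t ht z => hT4 t ht z) (fun t ht => havg t ht) i hiK.le e
  · exact H F θ hFL hθ0 J K hJK α hwin hαpos h24 hδ hαα s₀ hs₀ (descendTo F ℰp J K hJK U₀) hV U₁ hU₁f hU₁g hU₁top g₀ wt
      (fun t => lift t (GaugeField.gaugeAct (g₀ (t + 1)) (Averaging.iter (fun k => blockAvg (P := F.P K) (j := k) ℰp) (t + 1) U₁)))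
      (fun t _ b e' => hwt t b e') (fun t _ b => hlift t _ b) hg₀top (fun t ht z => hT4' t ht z) (fun t ht => havg₀ t ht) i hiK.le e

end Summit.QuantumFields.YangMills.Theorems.FluctuationComparisonRegPrIntLS2BetaArcDecayOfGuardBelow

end
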